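import Mathlib
import Summits.QuantumFields.YangMills.Theorems.BalabanUVNodesN15FirstOrderPerturbation
import HarnessLib

/-!
# Route «BalabanUVNodes» (cluster K4 «SpineRates»), Track-A DAG node N15 = spine estimate NE2, BACKGROUND LAYER — THE COEFFICIENTS OF THE PRINT's OWN FIRST-ORDER
# PERTURBATION `V′₁(A)` OF (3.52) ON THE FORWARD∕BACKWARD STACK, IN COORDINATES: `c = ad_W + Σ_μ[F′(ad A⁺_μ) + F′(ad A⁻_μ)]`, `a⁺_μ = ad A⁺_μ + ηF′(ad A⁺_μ)`,
# `a⁻_μ = ad A⁻_μ − ηF′(ad A⁻_μ)` as matrices on `𝔤 ≅ ℝ^ι`, and their max-row-sum letters ∕ fits from the (3.35)-shaped field letters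

Cell `pub-ymgap`, seat `pub-ymgap-dag-n15-c` (generation g2; R134 ACCELERATION SEAT, strategy s1 — first missing estimate after the (N1′) species: the
Laplacian-level `V′₁(A)` in the by-name layer; HUMAN RULING D-0062; chair R424 venue).  `bears_on: R4∕N15`.  Filed `--supports stmt-QuantumFields-19676` (K3;
helper).  Imports BY NAME, nothing in the tree modified: n15-b's part 17 `…N15FirstOrderPerturbation` (`rowBound_ad`, `rowFit_ad`, `rowBound_Phi2_ad`,
`rowFit_Phi2_ad`; through it parts 13a∕13b∕16 `adCLM`, `Phi2`, `coordMat`, `basisConst`).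

THE POINT.  The perturbation in Bałaban's Neumann series (3.63)–(3.65) for `G(U′U)` is `V′₁(A)` of [Balaban1985BackgroundPropagators] (3.52) p. 400 (first-hand):
*«(V′₁(A)λ)(x) = Σ_{b∈st(x)} i[A′(b), (D^η_U λ)(b)] + i[(D^{η*}_U A′)(x), λ(x)] + Σ_{b∈st(x)} F′_{1,k}(i ad_{A′(b)}) λ(b₊)»*, `F′_{1,k}(z) = η⁻²(e^{ηz} − 1 − ηz)` = 13b's
`Phi2`.  Part 17 typed it ONE DIRECTION AT A TIME at the sandwich level; the by-name layer (B1a∕M1: `X̂ = (1 − ĜV̂)⁻¹Ĝ` for a perturbation `V̂` DIAGONAL on the stack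
`(X, (D_jX)_j)`) was inhabited so far only by the covariant-DERIVATIVE species (C1∕G1: `D_U − ∇ = Phi1(η, ad A)∘S`).  OBSERVATION: in the `U ≡ 1` background
`V′₁(A)` IS DIAGONAL on the FORWARD∕BACKWARD stack `J ⊕ J` (derived pieces `∇⁺_μX` and `∇⁻_μX = (∇⁺_μX)(· − e_μ)`): the sum over the `2d` bonds `b ∈ st(x)` reads,
with `A⁺_μ(x) = A′(⟨x, x+e_μ⟩)`, `A⁻_μ(x) = A′(⟨x, x−e_μ⟩)`, `W = D*A′` and `λ(b₊) = λ(x) ± η(∇^±_μλ)(x)`,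
`V′₁(A) = M_c + Σ_μ [M_{a⁺_μ}∘∇⁺_μ + M_{a⁻_μ}∘∇⁻_μ]`, `c = ad_W + Σ_μ [F′(ad A⁺_μ) + F′(ad A⁻_μ)]`, `a⁺_μ = ad A⁺_μ + η·F′(ad A⁺_μ)`, `a⁻_μ = ad A⁻_μ − η·F′(ad A⁻_μ)`
(up to the print's `±i` conventions).  THIS FILE types the three coefficients in coordinates `e : 𝔄 ≃L[ℝ] ℝ^ι` (`𝔤` modelled by a complete normed algebra `𝔄`,
`ad` = commutator, parts 13a–c∕16) as functions of the triple `U = (A⁺, A⁻, W)` and proves their max-row-sum letters and row fits from (3.35)-shaped field letters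
(sup `‖·‖ ≤ r`, fit `≤ rθ`) in the `ad` regime `2r ≤ 1`, `η′ ≤ η ≤ min(1, θ)`; the carrier and M1's three perturbation letters are the sequel
`…N15BackgroundV1Species`.

CONTENTS ([folklore]; 2 defs).  §1 row letters of the two matrix species `ad` (LINEAR: fit without η-term) and `F′(ad ·) = Phi2 ∘ ad` (`rowSum_Phi2ad_le`,
`rowFit_ad_le`, `rowFit_Phi2ad_le`, `rowSum_smulPhi2ad_le`, `rowFit_smulPhi2ad_le`).  §2 `v1coefC`, `v1coefA` (defs), `rowSum_add_le`, `rowSum_sub_le`,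
`rowSum_sum_le`, and the letters `rowSum_v1coefC_le` (`≤ 4e(1+|J|)κ_e r`), `rowSum_v1coefA_le` (`≤ 4eκ_e r`), `rowFit_v1coefC` (`≤ 12e(1+|J|)κ_e rθ`), `rowFit_v1coefA`
(`≤ 10eκ_e rθ`).

HONEST FRAMING ∕ LIMITS.  SHAPES of (3.52) in the `U ≡ 1` background (the print's `D^η_U` carries parallel transports `R(U_b)` — here `U ≡ 1`); `𝔤 ↦ 𝔄` with
coordinates; crude constants.  NE2⁺ NOT PRINTED, NOT proved; count-neutral (typed 28∕28; nothing discharged); N15 NOT discharged; one finite lattice at fixed ε — NOT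
infinite volume, NOT OS on ℝ⁴, NOT a mass gap, NOT Clay.
-/

noncomputable section

open scoped BigOperators

namespace Summit.QuantumFields.YangMills.BalabanUVNodes.N15.BackgroundLayer

open Literature.MathematicalPhysics.QuantumFieldTheory.Balaban1983to89.Beta.AveragingCorrectionJets (adCLM)
open Summit.QuantumFields.YangMills.BalabanUVNodes.N15.MatrixSpecies (Phi2 coordMat basisConst basisConst_nonneg rowBound_ad rowFit_ad rowBound_Phi2_ad
  rowFit_Phi2_ad)

/-! ## §1 Row letters of the two matrix species `ad` and `F′(ad ·)` in the `ad` regime `2r ≤ 1` -/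

section Species

variable {X X' J ι : Type} [Fintype J] [Fintype ι] [DecidableEq ι] {𝔄 : Type} [NormedRing 𝔄] [NormedAlgebra ℝ 𝔄] [CompleteSpace 𝔄]
  (e : 𝔄 ≃L[ℝ] (ι → ℝ))

omit [Fintype J] in
/-- ROW LETTER of `F′(ad Z) = Phi2(s, ad Z)`: `≤ κ_e·e(2r)² ≤ κ_e·2e·r` on `‖Z‖ ≤ r`, `2r ≤ 1`, `0 ≤ s ≤ 1` (part 17 `rowBound_Phi2_ad`). [folklore] -/
theorem rowSum_Phi2ad_le {r s : ℝ} (hr : 0 ≤ r) (hr2 : 2 * r ≤ 1) (hs0 : 0 ≤ s) (hs : s ≤ 1) {a : X → 𝔄} (ha : ∀ x, ‖a x‖ ≤ r) (x : X) (i : ι) :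
    ∑ j, |coordMat e (Phi2 s (adCLM ℝ (a x))) i j| ≤ basisConst e * (2 * Real.exp 1 * r) := by
  have hreg : (1 : ℝ) * (2 * r) ≤ 1 := by rw [one_mul]; exact hr2
  refine (rowBound_Phi2_ad e hreg hr hs0 hs ha x i).trans (mul_le_mul_of_nonneg_left ?_ (basisConst_nonneg e))
  have he : 0 ≤ Real.exp 1 := Real.exp_nonneg 1
  nlinarith [mul_nonneg he hr]

omit [Fintype J] [CompleteSpace 𝔄] in
/-- ROW FIT of the LINEAR species `ad`: `≤ κ_e·2·(rθ)` from the field fit `rθ` (part 17 `rowFit_ad`; no spacing term). [folklore] -/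
theorem rowFit_ad_le (π : X' → X) {r θ : ℝ} {a' : X' → 𝔄} {a : X → 𝔄} (hfit : ∀ x', ‖a' x' - a (π x')‖ ≤ r * θ) (x' : X') (i : ι) :
    ∑ j, |coordMat e (adCLM ℝ (a' x')) i j - coordMat e (adCLM ℝ (a (π x'))) i j| ≤ basisConst e * (2 * (r * θ)) :=
  rowFit_ad e π (o := fun _ => r * θ) hfit x' i

omit [Fintype J] in
/-- ROW FIT of `F′(ad ·)`: `≤ κ_e·6e·rθ` (part 17 `rowFit_Phi2_ad`: `2e(2r)·rθ + 2e(2r)³η`, and `r ≤ ½`, `r²η ≤ rθ∕2`). [folklore] -/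
theorem rowFit_Phi2ad_le (π : X' → X) {r η η' θ : ℝ} (hr : 0 ≤ r) (hr2 : 2 * r ≤ 1) (hη' : 0 ≤ η') (hη'η : η' ≤ η) (hη1 : η ≤ 1) (hηθ : η ≤ θ)
    {a' : X' → 𝔄} {a : X → 𝔄} (ha' : ∀ x', ‖a' x'‖ ≤ r) (ha : ∀ x, ‖a x‖ ≤ r) (hfit : ∀ x', ‖a' x' - a (π x')‖ ≤ r * θ) (x' : X') (i : ι) :
    ∑ j, |coordMat e (Phi2 η' (adCLM ℝ (a' x'))) i j - coordMat e (Phi2 η (adCLM ℝ (a (π x')))) i j| ≤ basisConst e * (6 * Real.exp 1 * (r * θ)) := by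
  have hreg : (1 : ℝ) * (2 * r) ≤ 1 := by rw [one_mul]; exact hr2
  refine (rowFit_Phi2_ad e π hreg hr hη' hη'η hη1 ha' ha (o := fun _ => r * θ) hfit x' i).trans (mul_le_mul_of_nonneg_left ?_ (basisConst_nonneg e))
  have hη0 : 0 ≤ η := hη'.trans hη'η
  have he : 0 ≤ Real.exp 1 := Real.exp_nonneg 1
  have hrη : r * η ≤ 1 / 2 * θ := mul_le_mul (by linarith) hηθ hη0 (by norm_num)
  have h1 : r ^ 3 * η ≤ r * θ / 4 := by
    have hr1 : r ≤ 1 / 2 := by linarith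
    calc r ^ 3 * η = r * r * (r * η) := by ring
      _ ≤ r * (1 / 2) * (1 / 2 * θ) := by gcongr
      _ = r * θ / 4 := by ring
  have h2 : r * (r * θ) ≤ 1 / 2 * (r * θ) := mul_le_mul_of_nonneg_right (by linarith) (mul_nonneg hr (hη0.trans hηθ))
  calc (2 * (Real.exp 1 * (2 * r))) * (r * θ) + 2 * (Real.exp 1 * (2 * r) ^ 3) * η
      = 4 * Real.exp 1 * (r * (r * θ)) + 16 * Real.exp 1 * (r ^ 3 * η) := by ring
    _ ≤ 4 * Real.exp 1 * (1 / 2 * (r * θ)) + 16 * Real.exp 1 * (r * θ / 4) := by gcongr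
    _ = 6 * Real.exp 1 * (r * θ) := by ring

omit [Fintype J] in
/-- ROW LETTER of `η·F′(ad Z)`: `≤ κ_e·2e·r` for `0 ≤ η ≤ 1`. [folklore] -/
theorem rowSum_smulPhi2ad_le {r η : ℝ} (hr : 0 ≤ r) (hr2 : 2 * r ≤ 1) (hη0 : 0 ≤ η) (hη1 : η ≤ 1) {a : X → 𝔄} (ha : ∀ x, ‖a x‖ ≤ r) (x : X) (i : ι) :
    ∑ j, |(η • coordMat e (Phi2 η (adCLM ℝ (a x)))) i j| ≤ basisConst e * (2 * Real.exp 1 * r) := by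
  have h1 := rowSum_Phi2ad_le e hr hr2 hη0 hη1 ha x i
  calc ∑ j, |(η • coordMat e (Phi2 η (adCLM ℝ (a x)))) i j| = η * ∑ j, |coordMat e (Phi2 η (adCLM ℝ (a x))) i j| := by
        rw [Finset.mul_sum]
        refine Finset.sum_congr rfl fun j _ => ?_
        rw [Matrix.smul_apply, smul_eq_mul, abs_mul, abs_of_nonneg hη0]
    _ ≤ 1 * (basisConst e * (2 * Real.exp 1 * r)) := mul_le_mul hη1 h1 (Finset.sum_nonneg fun _ _ => abs_nonneg _) zero_le_one
    _ = _ := one_mul _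

omit [Fintype J] in
/-- ROW FIT of `η·F′(ad ·)`: `η′M′ − ηM̄ = η′(M′ − M̄) − (η − η′)M̄`, so `≤ κ_e·6e·rθ + θ·κ_e·2e·r = κ_e·8e·rθ`. [folklore] -/
theorem rowFit_smulPhi2ad_le (π : X' → X) {r η η' θ : ℝ} (hr : 0 ≤ r) (hr2 : 2 * r ≤ 1) (hη' : 0 ≤ η') (hη'η : η' ≤ η) (hη1 : η ≤ 1) (hηθ : η ≤ θ)
    {a' : X' → 𝔄} {a : X → 𝔄} (ha' : ∀ x', ‖a' x'‖ ≤ r) (ha : ∀ x, ‖a x‖ ≤ r) (hfit : ∀ x', ‖a' x' - a (π x')‖ ≤ r * θ) (x' : X') (i : ι) :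
    ∑ j, |(η' • coordMat e (Phi2 η' (adCLM ℝ (a' x')))) i j - (η • coordMat e (Phi2 η (adCLM ℝ (a (π x'))))) i j| ≤
      basisConst e * (8 * Real.exp 1 * (r * θ)) := by
  set M' : Matrix ι ι ℝ := coordMat e (Phi2 η' (adCLM ℝ (a' x'))) with hM'
  set M : Matrix ι ι ℝ := coordMat e (Phi2 η (adCLM ℝ (a (π x')))) with hM
  have hη0 : 0 ≤ η := hη'.trans hη'η
  have hθ0 : 0 ≤ θ := hη0.trans hηθ
  have h1 : ∑ j, |M' i j - M i j| ≤ basisConst e * (6 * Real.exp 1 * (r * θ)) := rowFit_Phi2ad_le e π hr hr2 hη' hη'η hη1 hηθ ha' ha hfit x' i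
  have h2 : ∑ j, |M i j| ≤ basisConst e * (2 * Real.exp 1 * r) := rowSum_Phi2ad_le e hr hr2 hη0 hη1 ha (π x') i
  have hsplit : ∀ j, (η' • M') i j - (η • M) i j = η' * (M' i j - M i j) - (η - η') * M i j := fun j => by
    simp only [Matrix.smul_apply, smul_eq_mul]; ring
  calc ∑ j, |(η' • M') i j - (η • M) i j| = ∑ j, |η' * (M' i j - M i j) - (η - η') * M i j| := Finset.sum_congr rfl fun j _ => by rw [hsplit]
    _ ≤ ∑ j, (η' * |M' i j - M i j| + (η - η') * |M i j|) := Finset.sum_le_sum fun j _ => by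
        refine (abs_sub _ _).trans (le_of_eq ?_)
        rw [abs_mul, abs_mul, abs_of_nonneg hη', abs_of_nonneg (by linarith : 0 ≤ η - η')]
    _ = η' * ∑ j, |M' i j - M i j| + (η - η') * ∑ j, |M i j| := by rw [Finset.sum_add_distrib, Finset.mul_sum, Finset.mul_sum]
    _ ≤ 1 * (basisConst e * (6 * Real.exp 1 * (r * θ))) + θ * (basisConst e * (2 * Real.exp 1 * r)) :=
        add_le_add (mul_le_mul (hη'η.trans hη1) h1 (Finset.sum_nonneg fun _ _ => abs_nonneg _) zero_le_one)
          (mul_le_mul (by linarith) h2 (Finset.sum_nonneg fun _ _ => abs_nonneg _) hθ0)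
    _ = basisConst e * (8 * Real.exp 1 * (r * θ)) := by ring

/-! ## §2 The coefficients of `V′₁(A)` on the forward∕backward stack, in coordinates, and their row letters -/

/-- THE ZEROTH-ORDER MATRIX COEFFICIENT of `V′₁(A)`: `c = coordMat(ad W) + Σ_μ [coordMat(F′(ad A⁺_μ)) + coordMat(F′(ad A⁻_μ))]` — the divergence commutator
`i[(D*A′)(x), ·]` plus the unshifted parts of the `F′_{1,k}` terms over the `2|J|` bonds at `x` (`λ(b₊) = λ(x) ± η∇^±_μλ(x)`).
[cite: Balaban1985BackgroundPropagators, (3.52) p.400 (shape)] -/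
def v1coefC (η : ℝ) (U : (J → X → 𝔄) × (J → X → 𝔄) × (X → 𝔄)) : X → Matrix ι ι ℝ := fun x =>
  coordMat e (adCLM ℝ (U.2.2 x)) + ∑ μ, (coordMat e (Phi2 η (adCLM ℝ (U.1 μ x))) + coordMat e (Phi2 η (adCLM ℝ (U.2.1 μ x))))

/-- THE FIRST-ORDER MATRIX COEFFICIENTS of `V′₁(A)` on the forward∕backward stack `J ⊕ J`: `a⁺_μ = coordMat(ad A⁺_μ) + η·coordMat(F′(ad A⁺_μ))` (forward bonds,
component `inl μ` = `∇⁺_μ`), `a⁻_μ = coordMat(ad A⁻_μ) − η·coordMat(F′(ad A⁻_μ))` (backward bonds, component `inr μ` = `∇⁻_μ`).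
[cite: Balaban1985BackgroundPropagators, (3.52) p.400 (shape)] -/
def v1coefA (η : ℝ) (U : (J → X → 𝔄) × (J → X → 𝔄) × (X → 𝔄)) : J ⊕ J → X → Matrix ι ι ℝ :=
  Sum.elim (fun μ x => coordMat e (adCLM ℝ (U.1 μ x)) + η • coordMat e (Phi2 η (adCLM ℝ (U.1 μ x))))
    (fun μ x => coordMat e (adCLM ℝ (U.2.1 μ x)) - η • coordMat e (Phi2 η (adCLM ℝ (U.2.1 μ x))))

omit [Fintype J] [DecidableEq ι] [NormedAlgebra ℝ 𝔄] [CompleteSpace 𝔄] in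
/-- Row sums are subadditive. [folklore] -/
theorem rowSum_add_le (P Q : Matrix ι ι ℝ) (i : ι) : ∑ j, |(P + Q) i j| ≤ ∑ j, |P i j| + ∑ j, |Q i j| := by
  rw [← Finset.sum_add_distrib]
  exact Finset.sum_le_sum fun j _ => by rw [Matrix.add_apply]; exact abs_add_le _ _

omit [Fintype J] [DecidableEq ι] [NormedAlgebra ℝ 𝔄] [CompleteSpace 𝔄] in
/-- Row sums of a difference. [folklore] -/
theorem rowSum_sub_le (P Q : Matrix ι ι ℝ) (i : ι) : ∑ j, |(P - Q) i j| ≤ ∑ j, |P i j| + ∑ j, |Q i j| := by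
  rw [← Finset.sum_add_distrib]
  exact Finset.sum_le_sum fun j _ => by rw [Matrix.sub_apply]; exact abs_sub _ _

omit [DecidableEq ι] [NormedAlgebra ℝ 𝔄] [CompleteSpace 𝔄] in
/-- Row sums of a finite sum of matrices. [folklore] -/
theorem rowSum_sum_le (Q : J → Matrix ι ι ℝ) (i : ι) : ∑ j, |(∑ μ, Q μ) i j| ≤ ∑ μ, ∑ j, |Q μ i j| := by
  calc ∑ j, |(∑ μ, Q μ) i j| = ∑ j, |∑ μ, Q μ i j| := by simp only [Matrix.sum_apply]
    _ ≤ ∑ j, ∑ μ, |Q μ i j| := Finset.sum_le_sum fun j _ => Finset.abs_sum_le_sum_abs _ _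
    _ = ∑ μ, ∑ j, |Q μ i j| := Finset.sum_comm

/-- ROW LETTER of `c`: `≤ κ_e(2r + |J|·4e·r) ≤ 4e(1+|J|)κ_e·r` on fields of size `≤ r`, `2r ≤ 1`, `0 ≤ η ≤ 1`. [folklore] -/
theorem rowSum_v1coefC_le {r η : ℝ} (hr : 0 ≤ r) (hr2 : 2 * r ≤ 1) (hη0 : 0 ≤ η) (hη1 : η ≤ 1) {U : (J → X → 𝔄) × (J → X → 𝔄) × (X → 𝔄)}
    (hU₁ : ∀ μ x, ‖U.1 μ x‖ ≤ r) (hU₂ : ∀ μ x, ‖U.2.1 μ x‖ ≤ r) (hU₃ : ∀ x, ‖U.2.2 x‖ ≤ r) (x : X) (i : ι) :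
    ∑ j, |v1coefC e η U x i j| ≤ 4 * Real.exp 1 * (1 + Fintype.card J) * basisConst e * r := by
  unfold v1coefC
  have hκ := basisConst_nonneg e
  have he : (1 : ℝ) ≤ Real.exp 1 := by have := Real.add_one_le_exp (1 : ℝ); linarith
  have hW := rowBound_ad e hU₃ x i
  have hsum : ∑ j, |(∑ μ, (coordMat e (Phi2 η (adCLM ℝ (U.1 μ x))) + coordMat e (Phi2 η (adCLM ℝ (U.2.1 μ x))))) i j| ≤
      Fintype.card J * (2 * (basisConst e * (2 * Real.exp 1 * r))) := by
    refine (rowSum_sum_le _ i).trans ?_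
    calc ∑ μ, ∑ j, |(coordMat e (Phi2 η (adCLM ℝ (U.1 μ x))) + coordMat e (Phi2 η (adCLM ℝ (U.2.1 μ x)))) i j|
        ≤ ∑ _μ : J, 2 * (basisConst e * (2 * Real.exp 1 * r)) := Finset.sum_le_sum fun μ _ =>
          (rowSum_add_le _ _ i).trans (by
            have h1 := rowSum_Phi2ad_le e hr hr2 hη0 hη1 (hU₁ μ) x i
            have h2 := rowSum_Phi2ad_le e hr hr2 hη0 hη1 (hU₂ μ) x i
            linarith)
      _ = Fintype.card J * (2 * (basisConst e * (2 * Real.exp 1 * r))) := by rw [Finset.sum_const, Finset.card_univ, nsmul_eq_mul]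
  refine (rowSum_add_le _ _ i).trans ?_
  have hJ : (0 : ℝ) ≤ Fintype.card J := Nat.cast_nonneg _
  nlinarith [hW, hsum, mul_nonneg hκ hr, mul_nonneg (mul_nonneg hJ hκ) hr]

omit [Fintype J] in
/-- ROW LETTER of `a^±_μ`: `≤ κ_e(2r + 2e·r) ≤ 4e·κ_e·r`. [folklore] -/
theorem rowSum_v1coefA_le {r η : ℝ} (hr : 0 ≤ r) (hr2 : 2 * r ≤ 1) (hη0 : 0 ≤ η) (hη1 : η ≤ 1) {U : (J → X → 𝔄) × (J → X → 𝔄) × (X → 𝔄)}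
    (hU₁ : ∀ μ x, ‖U.1 μ x‖ ≤ r) (hU₂ : ∀ μ x, ‖U.2.1 μ x‖ ≤ r) (jμ : J ⊕ J) (x : X) (i : ι) :
    ∑ j, |v1coefA e η U jμ x i j| ≤ 4 * Real.exp 1 * basisConst e * r := by
  have hκ := basisConst_nonneg e
  have he : (1 : ℝ) ≤ Real.exp 1 := by have := Real.add_one_le_exp (1 : ℝ); linarith
  rcases jμ with μ | μ
  · show ∑ j, |(coordMat e (adCLM ℝ (U.1 μ x)) + η • coordMat e (Phi2 η (adCLM ℝ (U.1 μ x)))) i j| ≤ _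
    have h1 := rowBound_ad e (hU₁ μ) x i
    have h2 := rowSum_smulPhi2ad_le e hr hr2 hη0 hη1 (hU₁ μ) x i
    refine (rowSum_add_le _ _ i).trans ?_
    nlinarith [mul_nonneg hκ hr]
  · show ∑ j, |(coordMat e (adCLM ℝ (U.2.1 μ x)) - η • coordMat e (Phi2 η (adCLM ℝ (U.2.1 μ x)))) i j| ≤ _
    have h1 := rowBound_ad e (hU₂ μ) x i
    have h2 := rowSum_smulPhi2ad_le e hr hr2 hη0 hη1 (hU₂ μ) x i
    refine (rowSum_sub_le _ _ i).trans ?_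
    nlinarith [mul_nonneg hκ hr]

variable (π : X' → X) {r η η' θ : ℝ} {U' : (J → X' → 𝔄) × (J → X' → 𝔄) × (X' → 𝔄)} {U : (J → X → 𝔄) × (J → X → 𝔄) × (X → 𝔄)}

/-- ROW FIT of `c`: `≤ κ_e(2 + 12e|J|)·rθ ≤ 12e(1+|J|)κ_e·rθ` from the three field fits `rθ`. [folklore] -/
theorem rowFit_v1coefC (hr : 0 ≤ r) (hr2 : 2 * r ≤ 1) (hη' : 0 ≤ η') (hη'η : η' ≤ η) (hη1 : η ≤ 1) (hηθ : η ≤ θ)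
    (hU'₁ : ∀ μ x', ‖U'.1 μ x'‖ ≤ r) (hU'₂ : ∀ μ x', ‖U'.2.1 μ x'‖ ≤ r) (hU₁ : ∀ μ x, ‖U.1 μ x‖ ≤ r) (hU₂ : ∀ μ x, ‖U.2.1 μ x‖ ≤ r)
    (hf₁ : ∀ μ x', ‖U'.1 μ x' - U.1 μ (π x')‖ ≤ r * θ) (hf₂ : ∀ μ x', ‖U'.2.1 μ x' - U.2.1 μ (π x')‖ ≤ r * θ)
    (hf₃ : ∀ x', ‖U'.2.2 x' - U.2.2 (π x')‖ ≤ r * θ) (x' : X') (i : ι) :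
    ∑ j, |v1coefC e η' U' x' i j - v1coefC e η U (π x') i j| ≤ 12 * Real.exp 1 * (1 + Fintype.card J) * basisConst e * (r * θ) := by
  have hκ := basisConst_nonneg e
  have he : (1 : ℝ) ≤ Real.exp 1 := by have := Real.add_one_le_exp (1 : ℝ); linarith
  have hθ0 : 0 ≤ θ := (hη'.trans hη'η).trans hηθ
  have hrθ : 0 ≤ r * θ := mul_nonneg hr hθ0
  have hsplit : v1coefC e η' U' x' - v1coefC e η U (π x') =
      (coordMat e (adCLM ℝ (U'.2.2 x')) - coordMat e (adCLM ℝ (U.2.2 (π x')))) +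
        ∑ μ, ((coordMat e (Phi2 η' (adCLM ℝ (U'.1 μ x'))) - coordMat e (Phi2 η (adCLM ℝ (U.1 μ (π x'))))) +
          (coordMat e (Phi2 η' (adCLM ℝ (U'.2.1 μ x'))) - coordMat e (Phi2 η (adCLM ℝ (U.2.1 μ (π x')))))) := by
    unfold v1coefC
    simp only [Finset.sum_add_distrib, Finset.sum_sub_distrib]
    abel
  have hW : ∑ j, |(coordMat e (adCLM ℝ (U'.2.2 x')) - coordMat e (adCLM ℝ (U.2.2 (π x')))) i j| ≤ basisConst e * (2 * (r * θ)) := by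
    simpa only [Matrix.sub_apply] using rowFit_ad_le e π hf₃ x' i
  have hsum : ∑ j, |(∑ μ, ((coordMat e (Phi2 η' (adCLM ℝ (U'.1 μ x'))) - coordMat e (Phi2 η (adCLM ℝ (U.1 μ (π x'))))) +
        (coordMat e (Phi2 η' (adCLM ℝ (U'.2.1 μ x'))) - coordMat e (Phi2 η (adCLM ℝ (U.2.1 μ (π x'))))))) i j| ≤
      Fintype.card J * (2 * (basisConst e * (6 * Real.exp 1 * (r * θ)))) := by
    refine (rowSum_sum_le _ i).trans ?_
    calc _ ≤ ∑ _μ : J, 2 * (basisConst e * (6 * Real.exp 1 * (r * θ))) := Finset.sum_le_sum fun μ _ =>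
          (rowSum_add_le _ _ i).trans (by
            have h1 : ∑ j, |(coordMat e (Phi2 η' (adCLM ℝ (U'.1 μ x'))) - coordMat e (Phi2 η (adCLM ℝ (U.1 μ (π x'))))) i j| ≤
                basisConst e * (6 * Real.exp 1 * (r * θ)) := by
              simpa only [Matrix.sub_apply] using rowFit_Phi2ad_le e π hr hr2 hη' hη'η hη1 hηθ (hU'₁ μ) (hU₁ μ) (hf₁ μ) x' i
            have h2 : ∑ j, |(coordMat e (Phi2 η' (adCLM ℝ (U'.2.1 μ x'))) - coordMat e (Phi2 η (adCLM ℝ (U.2.1 μ (π x'))))) i j| ≤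
                basisConst e * (6 * Real.exp 1 * (r * θ)) := by
              simpa only [Matrix.sub_apply] using rowFit_Phi2ad_le e π hr hr2 hη' hη'η hη1 hηθ (hU'₂ μ) (hU₂ μ) (hf₂ μ) x' i
            linarith)
      _ = Fintype.card J * (2 * (basisConst e * (6 * Real.exp 1 * (r * θ)))) := by rw [Finset.sum_const, Finset.card_univ, nsmul_eq_mul]
  have hJ : (0 : ℝ) ≤ Fintype.card J := Nat.cast_nonneg _
  calc ∑ j, |v1coefC e η' U' x' i j - v1coefC e η U (π x') i j| = ∑ j, |(v1coefC e η' U' x' - v1coefC e η U (π x')) i j| := by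
        simp only [Matrix.sub_apply]
    _ ≤ _ := by
        rw [hsplit]
        refine (rowSum_add_le _ _ i).trans ?_
        nlinarith [hW, hsum, mul_nonneg hκ hrθ, mul_nonneg (mul_nonneg hJ hκ) hrθ]

omit [Fintype J] in
/-- ROW FIT of `a^±_μ`: `≤ κ_e(2 + 8e)·rθ ≤ 10e·κ_e·rθ`. [folklore] -/
theorem rowFit_v1coefA (hr : 0 ≤ r) (hr2 : 2 * r ≤ 1) (hη' : 0 ≤ η') (hη'η : η' ≤ η) (hη1 : η ≤ 1) (hηθ : η ≤ θ)
    (hU'₁ : ∀ μ x', ‖U'.1 μ x'‖ ≤ r) (hU'₂ : ∀ μ x', ‖U'.2.1 μ x'‖ ≤ r) (hU₁ : ∀ μ x, ‖U.1 μ x‖ ≤ r) (hU₂ : ∀ μ x, ‖U.2.1 μ x‖ ≤ r)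
    (hf₁ : ∀ μ x', ‖U'.1 μ x' - U.1 μ (π x')‖ ≤ r * θ) (hf₂ : ∀ μ x', ‖U'.2.1 μ x' - U.2.1 μ (π x')‖ ≤ r * θ) (jμ : J ⊕ J) (x' : X') (i : ι) :
    ∑ j, |v1coefA e η' U' jμ x' i j - v1coefA e η U jμ (π x') i j| ≤ 10 * Real.exp 1 * basisConst e * (r * θ) := by
  have hκ := basisConst_nonneg e
  have he : (1 : ℝ) ≤ Real.exp 1 := by have := Real.add_one_le_exp (1 : ℝ); linarith
  have hθ0 : 0 ≤ θ := (hη'.trans hη'η).trans hηθ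
  have hrθ : 0 ≤ r * θ := mul_nonneg hr hθ0
  rcases jμ with μ | μ
  · have hsplit : v1coefA e η' U' (Sum.inl μ) x' - v1coefA e η U (Sum.inl μ) (π x') =
        (coordMat e (adCLM ℝ (U'.1 μ x')) - coordMat e (adCLM ℝ (U.1 μ (π x')))) +
          (η' • coordMat e (Phi2 η' (adCLM ℝ (U'.1 μ x'))) - η • coordMat e (Phi2 η (adCLM ℝ (U.1 μ (π x'))))) := by
      show (coordMat e (adCLM ℝ (U'.1 μ x')) + η' • coordMat e (Phi2 η' (adCLM ℝ (U'.1 μ x')))) -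
          (coordMat e (adCLM ℝ (U.1 μ (π x'))) + η • coordMat e (Phi2 η (adCLM ℝ (U.1 μ (π x'))))) = _
      abel
    have h1 : ∑ j, |(coordMat e (adCLM ℝ (U'.1 μ x')) - coordMat e (adCLM ℝ (U.1 μ (π x')))) i j| ≤ basisConst e * (2 * (r * θ)) := by
      simpa only [Matrix.sub_apply] using rowFit_ad_le e π (hf₁ μ) x' i
    have h2 : ∑ j, |(η' • coordMat e (Phi2 η' (adCLM ℝ (U'.1 μ x'))) - η • coordMat e (Phi2 η (adCLM ℝ (U.1 μ (π x'))))) i j| ≤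
        basisConst e * (8 * Real.exp 1 * (r * θ)) := by
      simpa only [Matrix.sub_apply] using rowFit_smulPhi2ad_le e π hr hr2 hη' hη'η hη1 hηθ (hU'₁ μ) (hU₁ μ) (hf₁ μ) x' i
    calc ∑ j, |v1coefA e η' U' (Sum.inl μ) x' i j - v1coefA e η U (Sum.inl μ) (π x') i j|
        = ∑ j, |(v1coefA e η' U' (Sum.inl μ) x' - v1coefA e η U (Sum.inl μ) (π x')) i j| := by simp only [Matrix.sub_apply]
      _ ≤ _ := by
          rw [hsplit]
          refine (rowSum_add_le _ _ i).trans ?_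
          nlinarith [h1, h2, mul_nonneg hκ hrθ]
  · have hsplit : v1coefA e η' U' (Sum.inr μ) x' - v1coefA e η U (Sum.inr μ) (π x') =
        (coordMat e (adCLM ℝ (U'.2.1 μ x')) - coordMat e (adCLM ℝ (U.2.1 μ (π x')))) -
          (η' • coordMat e (Phi2 η' (adCLM ℝ (U'.2.1 μ x'))) - η • coordMat e (Phi2 η (adCLM ℝ (U.2.1 μ (π x'))))) := by
      show (coordMat e (adCLM ℝ (U'.2.1 μ x')) - η' • coordMat e (Phi2 η' (adCLM ℝ (U'.2.1 μ x')))) -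
          (coordMat e (adCLM ℝ (U.2.1 μ (π x'))) - η • coordMat e (Phi2 η (adCLM ℝ (U.2.1 μ (π x'))))) = _
      abel
    have h1 : ∑ j, |(coordMat e (adCLM ℝ (U'.2.1 μ x')) - coordMat e (adCLM ℝ (U.2.1 μ (π x')))) i j| ≤ basisConst e * (2 * (r * θ)) := by
      simpa only [Matrix.sub_apply] using rowFit_ad_le e π (hf₂ μ) x' i
    have h2 : ∑ j, |(η' • coordMat e (Phi2 η' (adCLM ℝ (U'.2.1 μ x'))) - η • coordMat e (Phi2 η (adCLM ℝ (U.2.1 μ (π x'))))) i j| ≤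
        basisConst e * (8 * Real.exp 1 * (r * θ)) := by
      simpa only [Matrix.sub_apply] using rowFit_smulPhi2ad_le e π hr hr2 hη' hη'η hη1 hηθ (hU'₂ μ) (hU₂ μ) (hf₂ μ) x' i
    calc ∑ j, |v1coefA e η' U' (Sum.inr μ) x' i j - v1coefA e η U (Sum.inr μ) (π x') i j|
        = ∑ j, |(v1coefA e η' U' (Sum.inr μ) x' - v1coefA e η U (Sum.inr μ) (π x')) i j| := by simp only [Matrix.sub_apply]
      _ ≤ _ := by
          rw [hsplit]
          refine (rowSum_sub_le _ _ i).trans ?_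
          nlinarith [h1, h2, mul_nonneg hκ hrθ]

end Species

end Summit.QuantumFields.YangMills.BalabanUVNodes.N15.BackgroundLayer
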